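import Summits.AtomisticToContinuum.HydrodynamicLimit.Theorems.InformationPercolationEngineChaosClosesEulerReductionEos
import Summits.AtomisticToContinuum.HydrodynamicLimit.Theorems.InformationPercolationEngineChaosClosesEulerReductionSmooth
import Summits.AtomisticToContinuum.HydrodynamicLimit.Theorems.InformationPercolationEngineChaosClosesEulerReductionEuler
import Summits.AtomisticToContinuum.HydrodynamicLimit.Theorems.InformationPercolationEngineChaosClosesEulerReductionFields
import HarnessLib

/-!
# Kinetic reduction (crux `ChaosClosesEuler`, stmt-AtomisticToContinuum-15141, line `Sketch`,
# stub `stub_kineticReduction`) — helper: the clamped entropy weight, pointwise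

WHAT. The entropy input (H3) of the BF18 shell tests the clamped entropy `Z = max a (min s b)` of the field
`V = (ρ_r, m_r, e_r)` with the band-extension free energy `f`, whereas the clamped local second law (stmt-13352)
evaluates the CUT free energy `F_c(ρ_rσ³)`. Pointwise facts, for ONE configuration and ONE centre:

* `rho_mul_clampSh_eq`, `clampSh_mul_inner_eq` — under the density cap `ρ_rσ³ ≤ η₁` and the band agreement of `f`,
  the two weights coincide wherever they are multiplied by `ρ_r` or paired with `m_r` (on the empty cone both
  products vanish);
* `abs_clamp_le` — `|max a (min s b)| ≤ max |a| |b|`;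
* `measurable_clampL_orbit` — the cut weight read along a measurable curve of configurations is jointly measurable
  (the cut free energy is continuous on `[0, ∞)`);
* `abs_entropyIntegrand_le` — the (H3) integrand `ρ_r Z ∂ₜ(θ·cut) + Z ⟪m_r, ∇(θ·cut)⟫`, expanded by the product rule,
  is dominated by `C ρ_r + C' e_r`, and differences of two such integrands (two tests) likewise, with the sup norms of
  the differences of the tests as constants.

No named fact is invoked.
-/

noncomputable section

namespace Summit.AtomisticToContinuum.HydrodynamicLimit.Theorems.ChaosClosesEulerReduction

open scoped BigOperators Topology Classical MeasureTheory ENNReal InnerProductSpace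
open Filter Set MeasureTheory Function
open Literature.MathematicalPhysics.KineticTheory
open Literature.Analysis.FluidPDE
open Literature.Analysis.FunctionSpaces
open Summit.AtomisticToContinuum.HydrodynamicLimit.Theorems.LocalSecondLawNegative
open Summit.AtomisticToContinuum.HydrodynamicLimit.Theorems.LocalSecondLawLedger

variable {N : ℕ}

/-! ## §1 The two clamped weights coincide against `ρ_r` and `m_r` -/

/-- **The shell's clamped weight against the clamped law's, multiplied by the density.** Under the cap
`ρ_rσ³ ≤ η₁` and the band agreement `f a = f_ex(aσ³)` (`0 < a`, `aσ³ ≤ η₁`):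
`ρ_r · Z_shell(V) = ρ_r · Z_L(ρ_r, θ_r)`. [folklore] -/
theorem rho_mul_clampSh_eq {σ r : ℝ} (hr : 0 < r) (w : Phase N) (x : T3) {f : ℝ → ℝ} {η₁ a b : ℝ}
    (hband : ∀ c, 0 < c → c * σ ^ 3 ≤ η₁ → f c = hsExcessFreeEnergy (c * σ ^ 3))
    (hcap : rhoC r w x * σ ^ 3 ≤ η₁) :
    rhoC r w x * max a (min (3 / 2 * Real.log (thetaC r w x) - Real.log (rhoC r w x) - f (rhoC r w x)) b) =
      rhoC r w x * max a (min (3 / 2 * Real.log (thetaC r w x) - Real.log (rhoC r w x) -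
        (hsExcessFreeEnergy (min (rhoC r w x * σ ^ 3) η₁) +
          deriv hsExcessFreeEnergy η₁ * max (rhoC r w x * σ ^ 3 - η₁) 0)) b) := by
  by_cases h : rhoC r w x = 0
  · rw [h]; simp
  · have hρ : 0 < rhoC r w x := lt_of_le_of_ne (rhoC_nonneg hr w x) (Ne.symm h)
    rw [stub_reductionEos hcap, hband _ hρ hcap]

/-- **The same against the momentum.** [folklore] -/
theorem clampSh_mul_inner_eq {σ r : ℝ} (hr : 0 < r) (w : Phase N) (x : T3) {f : ℝ → ℝ} {η₁ a b : ℝ}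
    (hband : ∀ c, 0 < c → c * σ ^ 3 ≤ η₁ → f c = hsExcessFreeEnergy (c * σ ^ 3))
    (hcap : rhoC r w x * σ ^ 3 ≤ η₁) (g : V3) :
    max a (min (3 / 2 * Real.log (thetaC r w x) - Real.log (rhoC r w x) - f (rhoC r w x)) b) * ⟪momC r w x, g⟫_ℝ =
      max a (min (3 / 2 * Real.log (thetaC r w x) - Real.log (rhoC r w x) -
        (hsExcessFreeEnergy (min (rhoC r w x * σ ^ 3) η₁) +
          deriv hsExcessFreeEnergy η₁ * max (rhoC r w x * σ ^ 3 - η₁) 0)) b) * ⟪momC r w x, g⟫_ℝ := by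
  by_cases h : rhoC r w x = 0
  · rw [momC_eq_zero_of_rhoC hr h]; simp
  · have hρ : 0 < rhoC r w x := lt_of_le_of_ne (rhoC_nonneg hr w x) (Ne.symm h)
    rw [stub_reductionEos hcap, hband _ hρ hcap]

/-- `|max a (min s b)| ≤ max |a| |b|`. [folklore] -/
theorem abs_clamp_le (a b s : ℝ) : |max a (min s b)| ≤ max |a| |b| := by
  rcases le_total a (min s b) with h | h
  · rw [max_eq_right h]
    rcases le_total s b with h' | h'
    · rw [min_eq_left h'] at h ⊢
      exact abs_le_max_abs_abs h h'
    · rw [min_eq_right h']; exact le_max_right _ _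
  · rw [max_eq_left h]; exact le_max_left _ _

/-! ## §2 Measurability of the cut weight along an orbit -/

/-- A function continuous on `[0, ∞)` precomposed with `max · 0` is continuous on `ℝ`. [folklore] -/
theorem continuous_comp_max_zero {g : ℝ → ℝ} (hg : ContinuousOn g (Ici 0)) : Continuous fun c => g (max c 0) :=
  hg.comp_continuous (continuous_id.max continuous_const) fun _ => Set.mem_Ici.2 (le_max_right _ _)

/-- **The cut weight along a measurable curve of configurations is jointly measurable** (`F_c` continuous on
`[0, ∞)`, `log` measurable, `ρ_rσ³ ≥ 0`). [folklore] -/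
theorem measurable_clampL_orbit {γ : ℝ → Phase N} (hγ : Measurable γ) {r : ℝ} (hr : 0 < r) {σ : ℝ} (hσ3 : 0 ≤ σ ^ 3)
    (a b : ℝ) {Fc : ℝ → ℝ} (hFc : ContinuousOn Fc (Ici 0)) :
    Measurable fun p : ℝ × T3 => max a (min (3 / 2 * Real.log (thetaC r (γ p.1) p.2) -
      Real.log (rhoC r (γ p.1) p.2) - Fc (rhoC r (γ p.1) p.2 * σ ^ 3)) b) := by
  have hρ := measurable_rhoC_orbit hγ r
  have hθ := measurable_thetaC_orbit hγ r
  have hF : Measurable fun p : ℝ × T3 => Fc (rhoC r (γ p.1) p.2 * σ ^ 3) := by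
    have heq : (fun p : ℝ × T3 => Fc (rhoC r (γ p.1) p.2 * σ ^ 3)) =
        (fun c => Fc (max c 0)) ∘ fun p : ℝ × T3 => rhoC r (γ p.1) p.2 * σ ^ 3 := by
      funext p
      simp only [comp_apply]
      rw [max_eq_left (mul_nonneg (rhoC_nonneg hr _ _) hσ3)]
    rw [heq]
    exact (continuous_comp_max_zero hFc).measurable.comp (hρ.mul_const _)
  exact measurable_const.max ((((measurable_const.mul (Real.measurable_log.comp hθ)).sub
    (Real.measurable_log.comp hρ)).sub hF).min measurable_const)

/-! ## §3 The entropy integrand and its domination -/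

/-- **Domination of the entropy integrand.** For a weight `|Z| ≤ Zm`, test values `|q₁| ≤ Q₁` (the time derivative
of the test) and a test gradient `‖q₂‖ ≤ Q₂`: `|ρ_r Z q₁ + Z ⟪m_r, q₂⟫| ≤ (Zm Q₁ + Zm Q₂/2) ρ_r + Zm Q₂ e_r`. [folklore] -/
theorem abs_entropyIntegrand_le {r : ℝ} (hr : 0 < r) (w : Phase N) (x : T3) {Z q₁ Zm Q₁ Q₂ : ℝ} {q₂ : V3}
    (hZ : |Z| ≤ Zm) (hq₁ : |q₁| ≤ Q₁) (hq₂ : ‖q₂‖ ≤ Q₂) :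
    |rhoC r w x * Z * q₁ + Z * ⟪momC r w x, q₂⟫_ℝ| ≤ (Zm * Q₁ + Zm * Q₂ / 2) * rhoC r w x + Zm * Q₂ * kinC r w x := by
  have hZ0 : 0 ≤ Zm := (abs_nonneg _).trans hZ
  have hQ1 : 0 ≤ Q₁ := (abs_nonneg _).trans hq₁
  have hQ2 : 0 ≤ Q₂ := (norm_nonneg _).trans hq₂
  have hρ := rhoC_nonneg hr w x
  have hm : ‖momC r w x‖ ≤ rhoC r w x / 2 + kinC r w x := by
    have h := norm_momC_sq_le hr w x
    have hk := kinC_nonneg hr w x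
    nlinarith [sq_nonneg (‖momC r w x‖ - rhoC r w x / 2 - kinC r w x), norm_nonneg (momC r w x),
      sq_nonneg (rhoC r w x / 2 - kinC r w x)]
  have h1 : |rhoC r w x * Z * q₁| ≤ Zm * Q₁ * rhoC r w x := by
    rw [abs_mul, abs_mul, abs_of_nonneg hρ]
    calc rhoC r w x * |Z| * |q₁| ≤ rhoC r w x * Zm * Q₁ := by gcongr
      _ = Zm * Q₁ * rhoC r w x := by ring
  have h2 : |Z * ⟪momC r w x, q₂⟫_ℝ| ≤ Zm * Q₂ * (rhoC r w x / 2 + kinC r w x) := by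
    rw [abs_mul]
    have hi : |⟪momC r w x, q₂⟫_ℝ| ≤ ‖momC r w x‖ * ‖q₂‖ := abs_real_inner_le_norm _ _
    have hk := kinC_nonneg hr w x
    calc |Z| * |⟪momC r w x, q₂⟫_ℝ| ≤ Zm * (‖momC r w x‖ * ‖q₂‖) := by gcongr
      _ ≤ Zm * ((rhoC r w x / 2 + kinC r w x) * Q₂) := by gcongr
      _ = Zm * Q₂ * (rhoC r w x / 2 + kinC r w x) := by ring
  calc _ ≤ |rhoC r w x * Z * q₁| + |Z * ⟪momC r w x, q₂⟫_ℝ| := abs_add_le _ _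
    _ ≤ Zm * Q₁ * rhoC r w x + Zm * Q₂ * (rhoC r w x / 2 + kinC r w x) := add_le_add h1 h2
    _ = (Zm * Q₁ + Zm * Q₂ / 2) * rhoC r w x + Zm * Q₂ * kinC r w x := by ring

/-- **Domination of the difference of two entropy integrands with the same weight** (two tests):
`|ρ_r Z q₁ + Z⟪m_r, q₂⟫ − (ρ_r Z q₁' + Z⟪m_r, q₂'⟫)| ≤ (Zm D₁ + Zm D₂/2) ρ_r + Zm D₂ e_r` for `|q₁ − q₁'| ≤ D₁`,
`‖q₂ − q₂'‖ ≤ D₂`. [folklore] -/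
theorem abs_entropyIntegrand_sub_le {r : ℝ} (hr : 0 < r) (w : Phase N) (x : T3) {Z q₁ q₁' Zm D₁ D₂ : ℝ} {q₂ q₂' : V3}
    (hZ : |Z| ≤ Zm) (hq₁ : |q₁ - q₁'| ≤ D₁) (hq₂ : ‖q₂ - q₂'‖ ≤ D₂) :
    |rhoC r w x * Z * q₁ + Z * ⟪momC r w x, q₂⟫_ℝ - (rhoC r w x * Z * q₁' + Z * ⟪momC r w x, q₂'⟫_ℝ)| ≤
      (Zm * D₁ + Zm * D₂ / 2) * rhoC r w x + Zm * D₂ * kinC r w x := by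
  have heq : rhoC r w x * Z * q₁ + Z * ⟪momC r w x, q₂⟫_ℝ - (rhoC r w x * Z * q₁' + Z * ⟪momC r w x, q₂'⟫_ℝ) =
      rhoC r w x * Z * (q₁ - q₁') + Z * ⟪momC r w x, q₂ - q₂'⟫_ℝ := by
    rw [inner_sub_right]; ring
  rw [heq]
  exact abs_entropyIntegrand_le hr w x hZ hq₁ hq₂

/-! ## §4 The test of (H3): product rule and values -/

/-- **The time derivative of the (H3) test** `θ(s, x) · cut(τ₀, s)` within `[0, T)`:
`∂ₜ(θ cut)(s, x) = ∂ₜθ(s, x) cut(s) + θ(s, x) cut'(s)`, `s ∈ [0, T)`. [folklore] -/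
theorem timeDerivWithin_test {T : ℝ} {θ : ℝ → T3 → ℝ} (hθ : Torus.IsSmoothSpaceTimeOn (Ico 0 T) θ) (τ₀ Δ : ℝ)
    {s : ℝ} (hs : s ∈ Ico 0 T) (x : T3) :
    Torus.timeDerivWithin (Ico 0 T) (fun s' y => θ s' y * Real.smoothTransition ((τ₀ + Δ - s') / Δ)) s x =
      Torus.timeDerivWithin (Ico 0 T) θ s x * Real.smoothTransition ((τ₀ + Δ - s) / Δ) +
        θ s x * (deriv Real.smoothTransition ((τ₀ + Δ - s) / Δ) * (-Δ⁻¹)) :=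
  timeDerivWithin_mul_cut hθ (hasDerivAt_cut τ₀ Δ s) hs x

/-- **The gradient of the (H3) test**: `∇(θ(s) cut) = cut • ∇θ(s)` (`s ∈ [0, T)`). [folklore] -/
theorem gradient_test {T : ℝ} {θ : ℝ → T3 → ℝ} (hθ : Torus.IsSmoothSpaceTimeOn (Ico 0 T) θ) (c : ℝ) {s : ℝ}
    (hs : s ∈ Ico 0 T) (x : T3) :
    Torus.gradient (fun y => θ s y * c) x = c • Torus.gradient (θ s) x :=
  gradient_mul_const (isContDiff_one_slice hθ hs) c x

/-- **The time derivative of the shifted cut-off test of the clamped law on the plateau.** For the test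
`φ(s, x) = ζ(s) θ(s + e, x) cut(τ₀, s)` with `ζ = 1` near `s` and `s + e ∈ (0, T)`:
`∂ₜφ(s, x) = ∂ₜθ(s + e, x) cut(s) + θ(s + e, x) cut'(s)`. [folklore] -/
theorem timeDeriv_shiftTest {T : ℝ} {θ : ℝ → T3 → ℝ} (hθ : Torus.IsSmoothSpaceTimeOn (Ico 0 T) θ) {ζ : ℝ → ℝ}
    (τ₀ Δ e : ℝ) {s : ℝ} (hζ : ∀ᶠ s' in 𝓝 s, ζ s' = 1) (hs : s + e ∈ Ioo 0 T) (x : T3) :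
    Torus.timeDeriv (fun s' y => ζ s' * θ (s' + e) y * Real.smoothTransition ((τ₀ + Δ - s') / Δ)) s x =
      Torus.timeDerivWithin (Ico 0 T) θ (s + e) x * Real.smoothTransition ((τ₀ + Δ - s) / Δ) +
        θ (s + e) x * (deriv Real.smoothTransition ((τ₀ + Δ - s) / Δ) * (-Δ⁻¹)) := by
  unfold Torus.timeDeriv
  have h1 : deriv (fun s' => ζ s' * θ (s' + e) x * Real.smoothTransition ((τ₀ + Δ - s') / Δ)) s =
      deriv (fun s' => θ (s' + e) x * Real.smoothTransition ((τ₀ + Δ - s') / Δ)) s := by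
    refine Filter.EventuallyEq.deriv_eq ?_
    filter_upwards [hζ] with s' hs'
    rw [hs', one_mul]
  rw [h1]
  have hsI : s + e ∈ Ico 0 T := ⟨hs.1.le, hs.2⟩
  have hd : HasDerivWithinAt (fun τ => θ τ x) (Torus.timeDerivWithin (Ico 0 T) θ (s + e) x) (Ico 0 T) (s + e) :=
    hθ.hasDerivWithinAt_slice hsI x
  have hd' : HasDerivAt (fun τ => θ τ x) (Torus.timeDerivWithin (Ico 0 T) θ (s + e) x) (s + e) :=
    hd.hasDerivAt (mem_of_superset (Ioo_mem_nhds hs.1 hs.2) Ioo_subset_Ico_self)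
  have hcomp : HasDerivAt (fun s' => θ (s' + e) x) (Torus.timeDerivWithin (Ico 0 T) θ (s + e) x) s :=
    hd'.comp_add_const s e
  exact (hcomp.mul (hasDerivAt_cut τ₀ Δ s)).deriv

/-- **The gradient of the shifted cut-off test**: `∇φ(s) = (ζ(s) cut(s)) • ∇θ(s + e)` (`s + e ∈ [0, T)`). [folklore] -/
theorem gradient_shiftTest {T : ℝ} {θ : ℝ → T3 → ℝ} (hθ : Torus.IsSmoothSpaceTimeOn (Ico 0 T) θ) (ζ : ℝ → ℝ)
    (τ₀ Δ e : ℝ) {s : ℝ} (hs : s + e ∈ Ico 0 T) (x : T3) :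
    Torus.gradient (fun y => ζ s * θ (s + e) y * Real.smoothTransition ((τ₀ + Δ - s) / Δ)) x =
      (ζ s * Real.smoothTransition ((τ₀ + Δ - s) / Δ)) • Torus.gradient (θ (s + e)) x := by
  have h1 : (fun y => ζ s * θ (s + e) y * Real.smoothTransition ((τ₀ + Δ - s) / Δ)) =
      fun y => (ζ s * Real.smoothTransition ((τ₀ + Δ - s) / Δ)) * θ (s + e) y := by
    funext y; ring
  rw [h1]
  exact gradient_const_mul (isContDiff_one_slice hθ hs) _ x

/-- If a scalar test vanishes identically near the time `s`, its two-sided time derivative vanishes at `s`. [folklore] -/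
theorem timeDeriv_eq_zero_of_eventually {φ : ℝ → T3 → ℝ} {s : ℝ} (x : T3) (h : ∀ᶠ s' in 𝓝 s, φ s' x = 0) :
    Torus.timeDeriv φ s x = 0 := by
  unfold Torus.timeDeriv
  rw [Filter.EventuallyEq.deriv_eq (h.mono fun s' hs' => hs'), deriv_const]

/-- The gradient of a slice that is identically zero vanishes. [folklore] -/
theorem gradient_eq_zero_of_forall {φ : T3 → ℝ} (h : ∀ y, φ y = 0) (x : T3) : Torus.gradient φ x = 0 := by
  have hφ : φ = fun _ => 0 := funext h
  rw [hφ]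
  unfold Torus.gradient Torus.liftAt
  simp

/-! ## §5 The registered sub-goal -/

/-- **Registered sub-goal `stub_reductionEntropyPoint` (helper of `stub_kineticReduction`): the clamp is bounded by
its levels**, `|max a (min s b)| ≤ max |a| |b|` — the bound that makes the clamped entropy flux of cold, fast
far-field states harmless (the reason the reduction consumes the CLAMPED local second law). [folklore] -/
theorem stub_reductionEntropyPoint : ∀ a b s : ℝ, |max a (min s b)| ≤ max |a| |b| :=
  fun a b s => abs_clamp_le a b s

end Summit.AtomisticToContinuum.HydrodynamicLimit.Theorems.ChaosClosesEulerReduction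

end
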